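import Summits.Parity.GeneralizedHardyLittlewood.Theorems.BeyondDiagonalBeatsQuarter.PeterssonSplit
import Summits.Parity.GeneralizedHardyLittlewood.Theorems.BeyondDiagonalBeatsQuarter.CornerNegligibleXSq
import HarnessLib

/-!
# Route `PrimeLevelFamEdge`, crux K_B (stmt-Parity-20343), line `diagonal_kernel_split`:
# **the registered heart reduced to the OFF-DIAGONAL** — `stub_kernelExcessBelowSlack_io` follows from
# «i.o. along good primes, `−re Σ_{l,m} (x_l l^{−1/2})(x_m m^{−1/2})·OFF_q(l,m) ≤ U·mainScaleReal` with
# `U < 4(Δ′−1)/Δ′`», `OFF_q` the explicit Kloosterman–Bessel series `PeterssonSplit.offDiag`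

Composition of the exact split H4 (`PeterssonSplit.QhPQ_X_sq_one_split`: `Q^h(X²,1;M) = 2q̂ Σ x x·K_true − Σ
c c·OFF_q`) with the corner lemma H1 (`Corner.cornerNegligibleXSq`: `|Σ x x (K_true − kmvKernel)| ≤
ε·ms/(2q̂)` for `1 < Δ′ < 2` at every large level): the kernel excess is `2q̂·CORNER − re Σ c c·OFF_q`, so an
i.o. bound `U < slack` for the off-diagonal part gives an i.o. bound `U + ε < slack` for the excess (ε = half
the remaining slack). With `KernelExcessIO.beyondDiagonalBeatsQuarter_of_kernelExcess_io` (p619672) this makes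
K_B LITERALLY a statement about `offDiag` (STUB-PLAN §1.2 «H⁻ ⟺ OFF ≤ U·Σms i.o.», now kernel-checked);
plan Ω's Ω-d/Ω-f/Ω-g are the analysis of that series. Helper; closes nothing (the off-diagonal bound is the
hypothesis); standard axioms.
«The programme SEARCHES and TYPES; no claim about Landau–Siegel zeros, Theorems 1–2 of arXiv:2211.02515 or
a repaired Margin232 until a kernel theorem says so.»
-/

noncomputable section

open Finset Polynomial
open scoped Real ArithmeticFunction.Moebius

namespace Summit.Parity.GeneralizedHardyLittlewood.Theorems.BeyondDiagonalBeatsQuarter.PeterssonSplit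

open Literature.NumberTheory.LFunctions Literature.NumberTheory.LFunctions.KMV2000
open KernelFormXSq (xsq)

/-- The heart's mollifier weight is `xsq` (`(X²).eval t = t²`). [cite: KowalskiMichelVanderKam2000, (9) p. 7] -/
theorem heartWeight_eq_xsq (M : ℝ) (m : ℕ) :
    (ArithmeticFunction.moebius m : ℝ) * ((psi m)⁻¹ * (X ^ 2 : ℝ[X]).eval (Real.log (M / m) / Real.log M)) =
      xsq M m := by
  simp only [xsq, eval_pow, eval_X]

/-- `q̂^{Δ′} < q` for `Δ′ ≤ 2` and `q ≥ 40` (`q̂ = √q/2π < √q`, `q̂ > 1`). [cite: KowalskiMichelVanderKam2000, §2 p. 7] -/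
theorem qhat_rpow_lt_self {q : ℕ} (hq : 40 ≤ q) {Δ' : ℝ} (h2 : Δ' ≤ 2) :
    qhat q ^ Δ' < (q : ℝ) := by
  have hq1 : 1 < qhat q := one_lt_qhat hq
  have hq0 : (0 : ℝ) < q := by exact_mod_cast (by omega : 0 < q)
  have hsqrt : qhat q < Real.sqrt q := by
    unfold qhat
    rw [div_lt_iff₀ (by positivity)]
    have hs : 0 < Real.sqrt q := Real.sqrt_pos.2 hq0
    nlinarith [Real.pi_gt_three]
  calc qhat q ^ Δ' ≤ qhat q ^ (2 : ℝ) := Real.rpow_le_rpow_of_exponent_le hq1.le h2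
    _ = qhat q ^ 2 := by rw [← Real.rpow_natCast]; norm_num
    _ < Real.sqrt q ^ 2 := by gcongr
    _ = q := Real.sq_sqrt hq0.le

/-- **The heart reduced to the off-diagonal.** If for `Δ′` in a window `(1, b)` there is `U < 4(Δ′−1)/Δ′` such
that beyond every threshold some good prime `q` has
`−re Σ_{l,m ≤ M} (x_l l^{−1/2})(x_m m^{−1/2})·OFF_q(l,m) ≤ U·mainScaleReal Δ′ q` (`M = q̂^{Δ′}`), then the
registered heart `stub_kernelExcessBelowSlack_io` holds (verbatim conclusion, window `min b 2`).
[cite: KowalskiMichelVanderKam2000, (21)–(23) p. 12–13 and §6 p. 19 — derivation] -/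
theorem kernelExcessBelowSlack_io_of_offDiag_io
    (hOff : ∃ b : ℝ, 1 < b ∧ ∀ Δ' : ℝ, 1 < Δ' → Δ' < b → ∃ U : ℝ, U < 4 * (Δ' - 1) / Δ' ∧
      ∀ q₀ : ℕ, ∃ q : ℕ, ∃ _ : NeZero q, q₀ ≤ q ∧ q.Prime ∧
        (∀ n : ℕ, (n : ℝ) ≠ qhat q ^ Δ') ∧
          -(∑ l ∈ Icc 1 ⌊qhat q ^ Δ'⌋₊, ∑ m ∈ Icc 1 ⌊qhat q ^ Δ'⌋₊,
              ((mollifierCoeff (X ^ 2) (qhat q ^ Δ') l * mollifierCoeff (X ^ 2) (qhat q ^ Δ') m : ℝ) : ℂ) *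
                offDiag q l m).re ≤ U * mainScaleReal Δ' q) :
    ∃ b : ℝ, 1 < b ∧ ∀ Δ' : ℝ, 1 < Δ' → Δ' < b → ∃ U : ℝ, U < 4 * (Δ' - 1) / Δ' ∧
      ∀ q₀ : ℕ, ∃ q : ℕ, ∃ _ : NeZero q, q₀ ≤ q ∧ q.Prime ∧
        (∀ n : ℕ, (n : ℝ) ≠ qhat q ^ Δ') ∧
          (QhPQ q (X ^ 2) 1 (qhat q ^ Δ')).re -
              2 * qhat q *
                ∑ m₁ ∈ Icc 1 ⌊qhat q ^ Δ'⌋₊, ∑ m₂ ∈ Icc 1 ⌊qhat q ^ Δ'⌋₊,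
                  ((ArithmeticFunction.moebius m₁ : ℝ) *
                      ((psi m₁)⁻¹ * (X ^ 2 : ℝ[X]).eval
                        (Real.log (qhat q ^ Δ' / m₁) / Real.log (qhat q ^ Δ')))) *
                    ((ArithmeticFunction.moebius m₂ : ℝ) *
                      ((psi m₂)⁻¹ * (X ^ 2 : ℝ[X]).eval
                        (Real.log (qhat q ^ Δ' / m₂) / Real.log (qhat q ^ Δ')))) *
                    kmvKernel (Real.log (qhat q)) m₁ m₂ ≤
            U * mainScaleReal Δ' q := by
  obtain ⟨b, hb, H⟩ := hOff
  refine ⟨min b 2, lt_min hb (by norm_num), fun Δ' h1 h2 ↦ ?_⟩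
  have hΔb : Δ' < b := lt_of_lt_of_le h2 (min_le_left _ _)
  have hΔ2 : Δ' < 2 := lt_of_lt_of_le h2 (min_le_right _ _)
  have hΔ0 : 0 < Δ' := by linarith
  obtain ⟨U, hU, HU⟩ := H Δ' h1 hΔb
  -- half the remaining slack goes to the corner
  set ε : ℝ := (4 * (Δ' - 1) / Δ' - U) / 2 with hε
  have hεpos : 0 < ε := by rw [hε]; linarith
  refine ⟨U + ε, by rw [hε]; linarith, fun q₀ ↦ ?_⟩
  obtain ⟨q₁, hq₁⟩ := Corner.cornerNegligibleXSq h1 hΔ2 hεpos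
  obtain ⟨q, inst, hqge, hqp, hgood, hoff⟩ := HU (max q₀ (max q₁ 40))
  have hq0 : q₀ ≤ q := le_trans (le_max_left _ _) hqge
  have hq1' : q₁ ≤ q := le_trans ((le_max_left _ _).trans (le_max_right _ _)) hqge
  have hq40 : 40 ≤ q := le_trans ((le_max_right _ _).trans (le_max_right _ _)) hqge
  refine ⟨q, inst, hq0, hqp, hgood, ?_⟩
  set M : ℝ := qhat q ^ Δ' with hM
  have hqhat1 : 1 < qhat q := one_lt_qhat hq40
  have hqhat0 : 0 < qhat q := lt_trans zero_lt_one hqhat1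
  have hM1 : 1 ≤ M := by
    rw [hM]; exact Real.one_le_rpow hqhat1.le hΔ0.le
  have hMq : M < q := qhat_rpow_lt_self hq40 hΔ2.le
  -- the exact split (H4) and the corner bound (H1)
  have hsplit := QhPQ_X_sq_one_split hqp hM1 hMq
  have hcorner := hq₁ q hq1'
  -- rewrite the heart's weights as `xsq`
  simp only [heartWeight_eq_xsq]
  rw [hsplit, Complex.sub_re, Complex.ofReal_re]
  -- 2q̂ Σ xx K_true − re Σ cc OFF − 2q̂ Σ xx K = 2q̂ Σ xx (K_true − K) − re Σ cc OFF
  have hK : 2 * qhat q * ∑ l ∈ Icc 1 ⌊M⌋₊, ∑ m ∈ Icc 1 ⌊M⌋₊, xsq M l * xsq M m * Corner.trueDiagKernel (qhat q) l m -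
      2 * qhat q * ∑ m₁ ∈ Icc 1 ⌊M⌋₊, ∑ m₂ ∈ Icc 1 ⌊M⌋₊, xsq M m₁ * xsq M m₂ * kmvKernel (Real.log (qhat q)) m₁ m₂ =
      2 * qhat q * ∑ m₁ ∈ Icc 1 ⌊M⌋₊, ∑ m₂ ∈ Icc 1 ⌊M⌋₊,
        xsq M m₁ * xsq M m₂ * (Corner.trueDiagKernel (qhat q) m₁ m₂ - kmvKernel (Real.log (qhat q)) m₁ m₂) := by
    rw [← mul_sub, ← Finset.sum_sub_distrib]
    congr 1
    refine Finset.sum_congr rfl fun m₁ _ ↦ ?_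
    rw [← Finset.sum_sub_distrib]
    refine Finset.sum_congr rfl fun m₂ _ ↦ ?_
    ring
  have hcorner' : 2 * qhat q * ∑ m₁ ∈ Icc 1 ⌊M⌋₊, ∑ m₂ ∈ Icc 1 ⌊M⌋₊,
      xsq M m₁ * xsq M m₂ * (Corner.trueDiagKernel (qhat q) m₁ m₂ - kmvKernel (Real.log (qhat q)) m₁ m₂) ≤
      ε * mainScaleReal Δ' q := by
    have h := (abs_le.1 hcorner).2
    have h2q : 0 < 2 * qhat q := by positivity
    calc 2 * qhat q * _ ≤ 2 * qhat q * (ε * mainScaleReal Δ' q / (2 * qhat q)) :=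
          mul_le_mul_of_nonneg_left h h2q.le
      _ = ε * mainScaleReal Δ' q := by field_simp
  linarith [hK, hcorner', hoff]

end Summit.Parity.GeneralizedHardyLittlewood.Theorems.BeyondDiagonalBeatsQuarter.PeterssonSplit
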